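import Mathlib
import HarnessLib
import Summits.Ventures.LatticeQCDFlow.Exactness.PairOrbitLaw

/-!
# Polar form of the two laws compared by the spreading inequality: a shrunken Gaussian pair block and a kicked Gaussian single block

HONEST FRAMING: exact (Metropolis-corrected) sampling algorithms for lattice gauge theory;
figures of merit are autocorrelation/cost numbers at stated couplings and volumes; no
continuum-physics claim.

Venture `LatticeQCDFlow` (cell pub-lqcd), topic `Exactness`, FANOUT row 9 (eng-latcore, the
engine `latflow.core`; `update_link` in `csrc/latcore_template.c` runs one Cabibbo–Marinari
heat-bath hit per coordinate pair).  NEW WORK of the cell over Mathlib and row 9's earlier files;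
nothing is cited as a fact.  Part of the proof that the SU(N ≥ 3) Cabibbo–Marinari heat bath is
uniformly ergodic (the convolution of the SU(2)-pair Haar measures dominates Haar on `SU(N)`).

## What is proved (`n` a finite nonempty index type, `E n = ℝ^{n ⊕ n} ≅ ℂ^n`, `S n` its unit sphere)

* `norm_smul_coe_dirSphere`; **`stdGaussian_map_smul_projE_pair`** — the law of `c · p_{a,b} G` is
  the image of `subLaw {a,b} ⊗ (radLaw {a,b} scaled by c)` under `(σ, r) ↦ r σ`;
  `rotC_eq_self_of_supported` (an element of `coordSubgroup Q` fixes vectors supported off `Q`);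
  `pairKick a b` (`(h, v) ↦ φ(h) v`), measurable; **`pairKick_law`** — the law of `φ(h) · p_{a} G`
  (`h ∼` Haar(SU(2)) independent of the Gaussian `G`) is the image of `subLaw {a,b} ⊗ radLaw {a}`
  under `(σ, r) ↦ r σ`: the kick spreads the direction uniformly over the pair sphere and keeps
  the length.

NOT CLAIMED: anything beyond these two representations (the comparison itself is `SphereSpreading.lean`).
-/

namespace Summit.Ventures.LatticeQCDFlow.Exactness

open Matrix MeasureTheory WithLp Metric Complex ProbabilityTheory Measure Set
open scoped ENNReal

variable {n : Type*} [Fintype n] [DecidableEq n]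

/-! ## §3 The two laws to compare, in polar form -/

section Reps

variable [Nonempty n]

omit [DecidableEq n] in
/-- A nonzero vector is its length times its direction. -/
theorem norm_smul_coe_dirSphere {y : E n} (hy : y ≠ 0) : ‖y‖ • (dirSphere y : E n) = y := by
  rw [dirSphere_coe hy, smul_smul, mul_inv_cancel₀ (norm_ne_zero_iff.2 hy), one_smul]

/-- **Target in polar form**: the law of `c · p_Q G` (`Q = {a, b}`, any real `c`) is the image of
`subLaw Q ⊗ (radLaw Q scaled by c)` under `(σ, r) ↦ r σ`. -/
theorem stdGaussian_map_smul_projE_pair (a b : n) (hab : a ≠ b) (c : ℝ) :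
    (stdGaussian (E n)).map (fun x => c • projE {a, b} x) =
      ((subLaw ({a, b} : Finset n)).prod ((radLaw ({a, b} : Finset n)).map (fun r => c * r))).map
        (fun p : S n × ℝ => p.2 • (p.1 : E n)) := by
  have hQne : ({a, b} : Finset n).Nonempty := Finset.insert_nonempty a {b}
  have hpair : Measurable fun x : E n => (dirSphere (projE {a, b} x), ‖projE {a, b} x‖) :=
    (measurable_dirSphere_projE _).prodMk (measurable_projE _).norm
  have hsm : Measurable fun p : S n × ℝ => p.2 • (p.1 : E n) :=
    measurable_snd.smul (measurable_subtype_coe.comp measurable_fst)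
  have hsc : Measurable fun p : S n × ℝ => (p.1, c * p.2) := measurable_fst.prodMk (measurable_snd.const_mul c)
  -- a.e. `c • p_Q x = (c ‖p_Q x‖) • dir (p_Q x)`
  have hae : (fun x : E n => c • projE {a, b} x) =ᵐ[stdGaussian (E n)]
      (fun p : S n × ℝ => p.2 • (p.1 : E n)) ∘ ((fun p : S n × ℝ => (p.1, c * p.2)) ∘
        (fun x => (dirSphere (projE {a, b} x), ‖projE {a, b} x‖))) := by
    filter_upwards [compl_mem_ae_iff.2 (stdGaussian_projE_eq_zero hQne)] with x hx
    have hx' : projE {a, b} x ≠ 0 := hx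
    change c • projE {a, b} x = (c * ‖projE {a, b} x‖) • (dirSphere (projE {a, b} x) : E n)
    rw [mul_smul, norm_smul_coe_dirSphere hx']
  rw [Measure.map_congr hae, ← Measure.map_map hsm (hsc.comp hpair), ← Measure.map_map hsc hpair,
    stdGaussian_map_dir_norm_pair a b hab]
  congr 1
  have h := Measure.map_prod_map (subLaw ({a, b} : Finset n)) (radLaw ({a, b} : Finset n)) measurable_id
    (measurable_const_mul c)
  rw [Measure.map_id] at h
  rw [h]
  rfl

omit [Nonempty n] in
/-- An element of `coordSubgroup Q` fixes every vector supported outside `Q`. -/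
theorem rotC_eq_self_of_supported {Q : Finset n} {g : Matrix.specialUnitaryGroup n ℂ}
    (hg : g ∈ coordSubgroup Q) {x : E n} (hx : ∀ c ∈ Q, cplx x c = 0) :
    rotC (g : Matrix n n ℂ) (Matrix.specialUnitaryGroup_le_unitaryGroup g.2) x = x := by
  have hmv : ∀ (v : n → ℂ) (a : n), ((g : Matrix n n ℂ) *ᵥ v) a = ∑ b, (g : Matrix n n ℂ) a b * v b :=
    fun v a => rfl
  apply cplx_injective
  rw [cplx_rotC]
  funext a
  by_cases ha : a ∈ Q
  · rw [hx a ha, hmv]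
    refine Finset.sum_eq_zero fun b _ => ?_
    by_cases hb : b ∈ Q
    · rw [hx b hb, mul_zero]
    · rw [(hg b hb a).1, if_neg (fun h : a = b => hb (h ▸ ha)), zero_mul]
  · exact mulVec_apply_of_not_mem hg ha _

/-- The kick `v ↦ φ(h) v` on the `{a}`-block. -/
noncomputable def pairKick (a b : n) (hab : a ≠ b) (p : Matrix.specialUnitaryGroup (Fin 2) ℂ × E n) : E n :=
  rotC (pairHom a b hab p.1 : Matrix n n ℂ) (Matrix.specialUnitaryGroup_le_unitaryGroup (pairHom a b hab p.1).2) p.2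

omit [Nonempty n] in
/-- It is jointly continuous, hence measurable. -/
theorem measurable_pairKick (a b : n) (hab : a ≠ b) : Measurable (pairKick a b hab) := by
  have h : Continuous fun p : Matrix.specialUnitaryGroup (Fin 2) ℂ × E n =>
      rvec (((pairHom a b hab p.1 : Matrix.specialUnitaryGroup n ℂ) : Matrix n n ℂ) *ᵥ cplx p.2) :=
    continuous_rvec.comp (((continuous_subtype_val.comp ((continuous_blockEmb _).comp
      continuous_subtype_val |>.subtype_mk _)).comp continuous_fst).matrix_mulVec (continuous_cplx.comp continuous_snd))
  have heq : pairKick a b hab = fun p => rvec (((pairHom a b hab p.1 : Matrix.specialUnitaryGroup n ℂ) : Matrix n n ℂ) *ᵥ cplx p.2) := by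
    funext p; exact rotC_apply _ _
  rw [heq]
  exact h.measurable

/-- **The kick law in polar form**: the law of `φ(h) · p_{a} G` (`h ∼` Haar(SU(2)), `G` Gaussian,
independent) is the image of `subLaw {a, b} ⊗ radLaw {a}` under `(σ, r) ↦ r σ` — the kick spreads
the direction uniformly over the pair sphere and keeps the length. -/
theorem pairKick_law (a b : n) (hab : a ≠ b) :
    (haarSU2.prod ((stdGaussian (E n)).map (projE {a}))).map (pairKick a b hab) =
      ((subLaw ({a, b} : Finset n)).prod (radLaw ({a} : Finset n))).map
        (fun p : S n × ℝ => p.2 • (p.1 : E n)) := by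
  have hane : ({a} : Finset n).Nonempty := Finset.singleton_nonempty a
  have hsm : Measurable fun p : S n × ℝ => p.2 • (p.1 : E n) :=
    measurable_snd.smul (measurable_subtype_coe.comp measurable_fst)
  -- rewrite the left side as a push-forward of `η ⊗ γ`
  have h1 : haarSU2.prod ((stdGaussian (E n)).map (projE {a})) =
      (haarSU2.prod (stdGaussian (E n))).map (Prod.map id (projE {a})) := by
    rw [← Measure.map_prod_map _ _ measurable_id (measurable_projE _), Measure.map_id]
  rw [h1, Measure.map_map (measurable_pairKick a b hab) (measurable_id.prodMap (measurable_projE _))]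
  ext A hA
  have hF : Measurable fun p : Matrix.specialUnitaryGroup (Fin 2) ℂ × E n =>
      A.indicator (1 : E n → ℝ≥0∞) (pairKick a b hab (p.1, projE {a} p.2)) :=
    (measurable_one.indicator hA).comp ((measurable_pairKick a b hab).comp
      (measurable_fst.prodMk ((measurable_projE _).comp measurable_snd)))
  have hG : Measurable fun p : S n × ℝ => A.indicator (1 : E n → ℝ≥0∞) (p.2 • (p.1 : E n)) :=
    (measurable_one.indicator hA).comp hsm
  -- `Φ r = subLaw Q {σ | r σ ∈ A}`
  set Φ : ℝ → ℝ≥0∞ := fun r => ∫⁻ σ, A.indicator (1 : E n → ℝ≥0∞) (r • (σ : E n)) ∂(subLaw ({a, b} : Finset n)) with hΦ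
  have hΦm : Measurable Φ := by
    have h := (show Measurable (Function.uncurry fun (r : ℝ) (σ : S n) =>
        A.indicator (1 : E n → ℝ≥0∞) (r • (σ : E n))) from
      (measurable_one.indicator hA).comp (measurable_fst.smul (measurable_subtype_coe.comp measurable_snd)))
    exact h.lintegral_prod_right'
  rw [Measure.map_apply ((measurable_pairKick a b hab).comp (measurable_id.prodMap (measurable_projE _))) hA,
    Measure.map_apply hsm hA, ← lintegral_indicator_one (((measurable_pairKick a b hab).comp
      (measurable_id.prodMap (measurable_projE _))) hA), ← lintegral_indicator_one (hsm hA)]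
  change ∫⁻ p, A.indicator (1 : E n → ℝ≥0∞) (pairKick a b hab (p.1, projE {a} p.2)) ∂(haarSU2.prod (stdGaussian (E n))) =
    ∫⁻ p, A.indicator (1 : E n → ℝ≥0∞) (p.2 • (p.1 : E n)) ∂((subLaw ({a, b} : Finset n)).prod (radLaw {a}))
  rw [lintegral_prod_symm _ hF.aemeasurable, lintegral_prod_symm _ hG.aemeasurable, radLaw,
    lintegral_map hΦm (measurable_projE _).norm]
  refine lintegral_congr_ae ?_
  filter_upwards [compl_mem_ae_iff.2 (stdGaussian_projE_eq_zero hane)] with x hx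
  have hx' : projE {a} x ≠ 0 := hx
  -- the direction `u = dir (p_a x)` lies on the sub-sphere of `{a} ⊆ Q`
  set u : S n := dirSphere (projE {a} x) with hu
  have huQ : ∀ c ∉ ({a, b} : Finset n), cplx (u : E n) c = 0 := by
    intro c hc
    have hca : c ∉ ({a} : Finset n) := fun h => hc (by
      rw [Finset.mem_singleton] at h; simp [h])
    rw [hu, dirSphere_coe hx', cplx_smul, Pi.smul_apply, cplx_projE_of_not_mem _ x hca, smul_zero]
  -- inner integral over the kick = integral against the orbit law from `u` = `subLaw Q`
  have hkick : ∀ h : Matrix.specialUnitaryGroup (Fin 2) ℂ,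
      pairKick a b hab (h, projE {a} x) = ‖projE {a} x‖ • (actSU (pairHom a b hab h) u : E n) := by
    intro h
    rw [pairKick, coe_actSU, hu, ← LinearIsometryEquiv.map_smul, norm_smul_coe_dirSphere hx']
  simp_rw [hkick]
  change ∫⁻ h, A.indicator (1 : E n → ℝ≥0∞) (‖projE {a} x‖ • (actSU (pairHom a b hab h) u : E n)) ∂haarSU2 = Φ ‖projE {a} x‖
  have hint : Measurable fun σ : S n => A.indicator (1 : E n → ℝ≥0∞) (‖projE {a} x‖ • (σ : E n)) :=
    (measurable_one.indicator hA).comp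
      (show Measurable (fun σ : S n => ‖projE {a} x‖ • (σ : E n)) from
        (measurable_const_smul _).comp measurable_subtype_coe)
  rw [hΦ]
  change _ = ∫⁻ σ, A.indicator (1 : E n → ℝ≥0∞) (‖projE {a} x‖ • (σ : E n)) ∂(subLaw ({a, b} : Finset n))
  rw [← pairLaw_map_orbMap a b hab, ← map_act_eq_map_orbMap (pairLaw a b hab) (pairLaw_trans a b hab) u huQ,
    pairLaw, lintegral_map hint (measurable_actSU_left u),
    lintegral_map (show Measurable (fun g : Matrix.specialUnitaryGroup n ℂ =>
        A.indicator (1 : E n → ℝ≥0∞) (‖projE {a} x‖ • (actSU g u : E n))) from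
      hint.comp (measurable_actSU_left u)) (measurable_pairHom a b hab)]

end Reps


end Summit.Ventures.LatticeQCDFlow.Exactness
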